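import Literature.AlgebraicGeometry.Frobenioids.PadicKummerRemark221
import Mathlib.RepresentationTheory.Homological.GroupCohomology.Hilbert90
import Mathlib.FieldTheory.Galois.Basic
import HarnessLib

/-!
# Frobenioids II, Remark 2.2.1: the Hilbert-90 injection `H¹(H_A, μ_N(A)) ↪ (E^× ∩ L^{×N})/E^{×N}`

Mochizuki, *The geometry of Frobenioids II*, Kyushu J. Math. **62** (2008) 401–460, §2, Remark 2.2.1
p. 18 [cite: MochizukiFrdII2008, Rmk 2.2.1 p.18]: "the [first cohomology module portion of the]
Galois-theoretic condition of Definition 2.2, (ii), (c), implies [upon translation into 'extension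
field-theoretic language'] that any element `f ∈ O^□(A)^H` admits an `N`-th root `g ∈ O^□(A)`".
abc-iut cell, D-0079 L-F [FrdI/II], F-1198 `SaturatedInvariantsAdmitRoots` general `N` («GAP-2R»
FILE-B; FILE-A `PadicKummerRemark221FixedFieldKummerInj`, (P1) `LocalUnitPowerIndexMonotone`
abc-iut-w5-d246; FILE-C = the closer, abc-iut-E-t32).
PROOF-ONLY (0 definitions): the `H_A`-side of condition (c) "in extension field-theoretic language"
at the arithmetic context `Def22Context.ofLocalField L H hH S` (`K` any field, `L ⊆ K̄` finite
normal, `H ⊴ G_K` open, `O^□(A) = O^□_L` a `Gal(L/K)`-stable submonoid `S ∋` the `N`-th roots of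
unity of `L`), `E := L^{H_A}` (`invariantField`):
* `exists_pow_eq_of_oneCocycle_HA` — every continuous `1`-cocycle `c : H_A → μ_N(O^□_L)` is a
  coboundary in `L^×`: `σ(α) = c(σ)·α`, `α ∈ L^×`, and `α^N ∈ E` (Noether's Hilbert 90, Mathlib
  `groupCohomology.isMulCoboundary₁_of_isMulCocycle₁_of_aut_to_units`, for `L/E`; `H_A = Gal(L/E)`
  by `IntermediateField.fixingSubgroup_fixedField`);
* `oneCocycleClass_eq_of_pow_eq` — cocycles whose Hilbert-90 elements satisfy `α^N = α'^N · e^N`,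
  `e ∈ E^×`, are cohomologous (`α/(α'e) ∈ μ_N(O^□_L)`); hypothesis (a) is NOT used on this side;
* `natCard_h1_HA_le_card_kummerQuotient` — **`#H¹(H_A, μ_N(O^□_L)) ≤ #((E^× ∩ L^{×N})/E^{×N})`**
  (relative index of `E^{×N}` in `E^× ∩ L^{×N} ≤ E^×`);
* `exists_pow_eq_of_index_le_natCard_h1`, `exists_pow_eq_of_isNHSaturated_of_index_le` — CONSUMER
  FORMS for the F-1198 closer: if `E^×/E^{×N}` is finite and `#(E^×/E^{×N}) ≤ #H¹(H_A, μ_N(O^□_L))`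
  (resp. `≤ #H¹(H, μ_N(O^□_L))` for an `(N, H)`-saturated `A`, via (c) counted,
  `natCard_h1_HA_eq_natCard_h1_H`), every nonzero `x ∈ E` is an `N`-th power in `L`.
Topologies (cf. the note in `PadicKummerGaloisFN.lean`): the topology of `H_A ≤ Aut_E(A_E)` and its
`IsTopologicalGroup` structure are IMPLICIT binders `{tE}`, `{tg}` read off the consumer's term
(for `IsNHSaturated X N`: the discrete instances of `PadicKummerSetting.lean`), not re-synthesised.
Nothing here concerns [IUTchIII]; classical Galois cohomology of a finite extension. Universe `0`.
-/

noncomputable section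

namespace Literature.AlgebraicGeometry.Frobenioids
open Field IntermediateField CategoryTheory
open Literature.NumberTheory.GaloisRepresentations

namespace PadicKummer
namespace GalMonoid

variable {K : Type} [Field K] {L : IntermediateField K (AlgebraicClosure K)} {S : StableSubmonoid L}
  {N : ℕ}

/-- The value in `L` of an element of `μ_N(O^□_L)` is multiplicative.
[cite: MochizukiFrdII2008, Def 2.1 (i) p.16] -/
theorem mu_val_mul (m m' : Kummer.Mu N (GalMonoid S)) :
    ((Kummer.Mu.val (m * m') : (GalMonoid S)ˣ) : GalMonoid S).val =
      ((Kummer.Mu.val m : (GalMonoid S)ˣ) : GalMonoid S).val *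
        ((Kummer.Mu.val m' : (GalMonoid S)ˣ) : GalMonoid S).val := by
  rw [Kummer.Mu.val_mul, Units.val_mul, val_mul]

/-- The value in `L` of an element of `μ_N(O^□_L)` is nonzero.
[cite: MochizukiFrdII2008, Def 2.1 (i) p.16] -/
theorem mu_val_ne_zero (m : Kummer.Mu N (GalMonoid S)) :
    ((Kummer.Mu.val m : (GalMonoid S)ˣ) : GalMonoid S).val ≠ 0 :=
  val_ne_zero _

/-- The value in `L` of an element of `μ_N(O^□_L)` is an `N`-th root of unity.
[cite: MochizukiFrdII2008, Def 2.1 (i) p.16] -/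
theorem mu_val_pow (m : Kummer.Mu N (GalMonoid S)) :
    ((Kummer.Mu.val m : (GalMonoid S)ˣ) : GalMonoid S).val ^ N = 1 := by
  have h : (Kummer.Mu.val m : (GalMonoid S)ˣ) ^ N = 1 := (mem_rootsOfUnity N _).mp m.val_mem
  rw [← val_pow, ← Units.val_pow_eq_pow_val, h, Units.val_one, val_one]

/-- The value in `L` of a quotient. [cite: MochizukiFrdII2008, Def 2.1 (i) p.16] -/
theorem mu_val_div (m m' : Kummer.Mu N (GalMonoid S)) :
    ((Kummer.Mu.val (m / m') : (GalMonoid S)ˣ) : GalMonoid S).val =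
      ((Kummer.Mu.val m : (GalMonoid S)ˣ) : GalMonoid S).val /
        ((Kummer.Mu.val m' : (GalMonoid S)ˣ) : GalMonoid S).val := by
  rw [eq_div_iff (mu_val_ne_zero m'), ← mu_val_mul, div_mul_cancel]

/-- An element of `μ_N(O^□_L)` is determined by its value in `L`.
[cite: MochizukiFrdII2008, Def 2.1 (i) p.16] -/
theorem mu_val_injective :
    Function.Injective fun m : Kummer.Mu N (GalMonoid S) =>
      ((Kummer.Mu.val m : (GalMonoid S)ˣ) : GalMonoid S).val :=
  fun _ _ h => Kummer.Mu.ext (Units.ext (ext h))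

/-- `Gal(L/K)` acts on the values of `μ_N(O^□_L)` through its action on `L`.
[cite: MochizukiFrdII2008, Def 2.1 (i) p.16] -/
theorem mu_val_smul (σ : L ≃ₐ[K] L) (m : Kummer.Mu N (GalMonoid S)) :
    ((Kummer.Mu.val (σ • m) : (GalMonoid S)ˣ) : GalMonoid S).val =
      σ (((Kummer.Mu.val m : (GalMonoid S)ˣ) : GalMonoid S).val) := by
  rw [Kummer.Mu.val_smul, Kummer.coe_unitsAct, val_smul, AlgEquiv.smul_def]

/-- Every `N`-th root of unity of `L` lying in `O^□_L` is the value of an element of `μ_N(O^□_L)`.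
[cite: MochizukiFrdII2008, Def 2.1 (i) p.16] -/
theorem exists_mu_val_eq (hS : ∀ x : L, x ^ N = 1 → x ∈ S.toSubmonoid) (hN : N ≠ 0) {ζ : L}
    (hζ : ζ ^ N = 1) :
    ∃ m : Kummer.Mu N (GalMonoid S),
      ((Kummer.Mu.val m : (GalMonoid S)ˣ) : GalMonoid S).val = ζ := by
  have hg : (mk ζ (hS ζ hζ) : GalMonoid S) ^ N = 1 :=
    ext (by rw [val_pow, val_mk, hζ, val_one])
  refine ⟨Kummer.Mu.mk (Units.ofPowEqOne _ N hg hN)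
    ((mem_rootsOfUnity N _).mpr (Units.pow_ofPowEqOne _ _)), ?_⟩
  rw [Kummer.Mu.val_mk, Units.val_ofPowEqOne, val_mk]

end GalMonoid

namespace Def22Context
variable {K : Type} [Field K] (L : IntermediateField K (AlgebraicClosure K))
  [Normal K L] [FiniteDimensional K L]
  (H : Subgroup (absoluteGaloisGroup K)) [H.Normal] (hH : IsOpen (H : Set (absoluteGaloisGroup K)))
  (S : StableSubmonoid L) (N : ℕ)

/-- **Remark 2.2.1** (FrdII p. 18), the field `E = L^H`: `H_A` is the full group `Gal(L/E)` of
`K`-automorphisms of `L` fixing `E := L^{H_A}` (the Galois correspondence for the finite extension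
`L/K`). [cite: MochizukiFrdII2008, Rmk 2.2.1 p.18] -/
theorem fixingSubgroup_invariantField :
    fixingSubgroup (invariantField L H hH S) = (ofLocalField L H hH S).HA :=
  fixingSubgroup_fixedField _

/-- An `E`-automorphism of `L`, regarded as a `K`-automorphism, lies in `H_A`.
[cite: MochizukiFrdII2008, Rmk 2.2.1 p.18] -/
theorem restrictScalars_mem_HA (φ : L ≃ₐ[invariantField L H hH S] L) :
    φ.restrictScalars K ∈ (ofLocalField L H hH S).HA := by
  rw [← fixingSubgroup_invariantField, IntermediateField.mem_fixingSubgroup_iff]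
  intro x hx
  exact φ.commutes (⟨x, hx⟩ : invariantField L H hH S)

/-- Elements of `H_A` fix `E = L^{H_A}` pointwise. [cite: MochizukiFrdII2008, Rmk 2.2.1 p.18] -/
theorem smul_eq_self_of_mem_invariantField (σ : (ofLocalField L H hH S).HA) {e : L}
    (he : e ∈ invariantField L H hH S) : (σ : L ≃ₐ[K] L) e = e :=
  (mem_fixedField_iff _ _).mp he _ σ.2

variable {tE : TopologicalSpace (ofLocalField L H hH S).AutE}
  {tg : IsTopologicalGroup (ofLocalField L H hH S).HA}

/-- **Remark 2.2.1, the `H_A`-side made "extension field-theoretic"** (FrdII p. 18): every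
continuous `1`-cocycle `c : H_A → μ_N(O^□_L)` (the coefficient module of Def. 2.2 (ii)(c)) is a
coboundary in `L^×` — there is `α ∈ L`, `α ≠ 0`, with `σ(α) = c(σ) · α` for all `σ ∈ H_A`, and then
`α^N ∈ E = L^{H_A}`. Noether's form of Hilbert's Theorem 90 for the finite extension `L/E`
(`H_A = Gal(L/E)`). [cite: MochizukiFrdII2008, Rmk 2.2.1 p.18] -/
theorem exists_pow_eq_of_oneCocycle_HA
    (c : contOneCocycles (Kummer.muTopRep N (GalMonoid S) (ofLocalField L H hH S).HA)) :
    ∃ α : L, α ≠ 0 ∧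
      (∀ σ : (ofLocalField L H hH S).HA, (σ : L ≃ₐ[K] L) α =
        ((Kummer.Mu.val (Additive.toMul (c.1 σ)) : (GalMonoid S)ˣ) : GalMonoid S).val * α) ∧
      α ^ N ∈ invariantField L H hH S := by
  classical
  -- Mathlib's action of `Gal(L/E)` on `Lˣ`, pinned (keeps the instance search short)
  letI : SMul (L ≃ₐ[invariantField L H hH S] L) (L : Type)ˣ :=
    (AlgEquiv.instMulDistribMulActionUnits (R := invariantField L H hH S)
      (A₁ := (L : Type))).toMulAction.toSMul
  -- the cocycle as a function `Gal(L/E) → Lˣ`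
  let v : Kummer.Mu N (GalMonoid S) → (L : Type)ˣ := fun m =>
    Units.mk0 (((Kummer.Mu.val m : (GalMonoid S)ˣ) : GalMonoid S).val) (GalMonoid.mu_val_ne_zero m)
  let f : (L ≃ₐ[invariantField L H hH S] L) → (L : Type)ˣ := fun φ =>
    v (Additive.toMul (c.1 ⟨φ.restrictScalars K, restrictScalars_mem_HA L H hH S φ⟩))
  have hmul : ∀ φ ψ : L ≃ₐ[invariantField L H hH S] L,
      (⟨(φ * ψ).restrictScalars K, restrictScalars_mem_HA L H hH S (φ * ψ)⟩ :
          (ofLocalField L H hH S).HA) =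
        ⟨φ.restrictScalars K, restrictScalars_mem_HA L H hH S φ⟩ *
          ⟨ψ.restrictScalars K, restrictScalars_mem_HA L H hH S ψ⟩ :=
    fun φ ψ => Subtype.ext (AlgEquiv.ext fun x => rfl)
  have hf : groupCohomology.IsMulCocycle₁ f := by
    intro φ ψ
    apply Units.ext
    rw [Units.val_mul, AlgEquiv.smul_units_def, Units.coe_map, MonoidHom.coe_coe]
    simp only [f, v, Units.val_mk0]
    have hc := c.2 ⟨φ.restrictScalars K, restrictScalars_mem_HA L H hH S φ⟩
      ⟨ψ.restrictScalars K, restrictScalars_mem_HA L H hH S ψ⟩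
    rw [← hmul] at hc
    have hc2 : (Additive.toMul
          (c.1 ⟨(φ * ψ).restrictScalars K, restrictScalars_mem_HA L H hH S (φ * ψ)⟩) :
          Kummer.Mu N (GalMonoid S)) =
        (Additive.toMul (c.1 ⟨φ.restrictScalars K, restrictScalars_mem_HA L H hH S φ⟩) :
          Kummer.Mu N (GalMonoid S)) *
          ((φ.restrictScalars K : L ≃ₐ[K] L) •
            (Additive.toMul (c.1 ⟨ψ.restrictScalars K, restrictScalars_mem_HA L H hH S ψ⟩) :
              Kummer.Mu N (GalMonoid S))) := by
      rw [hc]; rfl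
    rw [hc2, GalMonoid.mu_val_mul, GalMonoid.mu_val_smul]
    exact mul_comm _ _
  -- Hilbert 90
  obtain ⟨β, hβ⟩ := groupCohomology.isMulCoboundary₁_of_isMulCocycle₁_of_aut_to_units f hf
  have key : ∀ σ : (ofLocalField L H hH S).HA, (σ : L ≃ₐ[K] L) (β : L) =
      ((Kummer.Mu.val (Additive.toMul (c.1 σ)) : (GalMonoid S)ˣ) : GalMonoid S).val * β := by
    intro σ
    have hσE : (σ : L ≃ₐ[K] L) ∈ fixingSubgroup (invariantField L H hH S) := by
      rw [fixingSubgroup_invariantField]; exact σ.2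
    let g : L ≃ₐ[invariantField L H hH S] L :=
      IntermediateField.fixingSubgroupEquiv (invariantField L H hH S) ⟨(σ : L ≃ₐ[K] L), hσE⟩
    have hg : ∀ x : L, g x = (σ : L ≃ₐ[K] L) x := fun x => rfl
    have hgσ : (⟨g.restrictScalars K, restrictScalars_mem_HA L H hH S g⟩ :
        (ofLocalField L H hH S).HA) = σ := Subtype.ext (AlgEquiv.ext hg)
    have h := congrArg (fun u : (L : Type)ˣ => (u : L)) (div_eq_iff_eq_mul.mp (hβ g))
    simp only [AlgEquiv.smul_units_def, Units.coe_map, MonoidHom.coe_coe, Units.val_mul, f, v,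
      Units.val_mk0, hgσ] at h
    rw [← hg]
    exact h
  refine ⟨(β : L), β.ne_zero, key, ?_⟩
  change ((β : L)) ^ N ∈ fixedField (ofLocalField L H hH S).HA
  rw [IntermediateField.mem_fixedField_iff]
  intro τ hτ
  rw [map_pow, show τ (β : L) = _ from key ⟨τ, hτ⟩, mul_pow, GalMonoid.mu_val_pow, one_mul]

/-- **Remark 2.2.1, injectivity of the Hilbert-90 translation** (FrdII p. 18): if two continuous
`1`-cocycles `c, c' : H_A → μ_N(O^□_L)` have Hilbert-90 elements `α, α'` with `α^N = α'^N · e^N`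
for some nonzero `e ∈ E = L^{H_A}`, then `c` and `c'` are cohomologous (their quotient is the
coboundary of `α/(α' e) ∈ μ_N(O^□_L)`; `O^□_L` contains the `N`-th roots of unity of `L`).
[cite: MochizukiFrdII2008, Rmk 2.2.1 p.18] -/
theorem oneCocycleClass_eq_of_pow_eq (hS : ∀ x : L, x ^ N = 1 → x ∈ S.toSubmonoid) (hN : N ≠ 0)
    {c c' : contOneCocycles (Kummer.muTopRep N (GalMonoid S) (ofLocalField L H hH S).HA)}
    {α α' e : L} (hα0 : α ≠ 0) (hα'0 : α' ≠ 0) (he0 : e ≠ 0) (he : e ∈ invariantField L H hH S)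
    (hα : ∀ σ : (ofLocalField L H hH S).HA, (σ : L ≃ₐ[K] L) α =
      ((Kummer.Mu.val (Additive.toMul (c.1 σ)) : (GalMonoid S)ˣ) : GalMonoid S).val * α)
    (hα' : ∀ σ : (ofLocalField L H hH S).HA, (σ : L ≃ₐ[K] L) α' =
      ((Kummer.Mu.val (Additive.toMul (c'.1 σ)) : (GalMonoid S)ˣ) : GalMonoid S).val * α')
    (hpow : α ^ N = α' ^ N * e ^ N) :
    oneCocycleClass _ c = oneCocycleClass _ c' := by
  -- `ζ := α/(α' e)` is an `N`-th root of unity of `L`, hence a value of `μ_N(O^□_L)`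
  have hζ : (α / (α' * e)) ^ N = 1 := by
    rw [div_pow, mul_pow, ← hpow, div_self (pow_ne_zero _ hα0)]
  obtain ⟨m, hm⟩ := GalMonoid.exists_mu_val_eq hS hN hζ
  rw [← sub_eq_zero, ← oneCocycleClass_sub, oneCocycleClass_eq_zero_iff]
  refine ⟨Additive.ofMul m, fun σ => ?_⟩
  apply Additive.toMul.injective
  change (Additive.toMul (c.1 σ) : Kummer.Mu N (GalMonoid S)) /
      (Additive.toMul (c'.1 σ) : Kummer.Mu N (GalMonoid S)) = ((σ : L ≃ₐ[K] L) • m) / m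
  apply GalMonoid.mu_val_injective
  change ((Kummer.Mu.val ((Additive.toMul (c.1 σ) : Kummer.Mu N (GalMonoid S)) /
      (Additive.toMul (c'.1 σ) : Kummer.Mu N (GalMonoid S))) : (GalMonoid S)ˣ) : GalMonoid S).val =
    ((Kummer.Mu.val (((σ : L ≃ₐ[K] L) • m) / m) : (GalMonoid S)ˣ) : GalMonoid S).val
  have hσe : (σ : L ≃ₐ[K] L) e = e := smul_eq_self_of_mem_invariantField L H hH S σ he
  rw [GalMonoid.mu_val_div, GalMonoid.mu_val_div, GalMonoid.mu_val_smul, hm, map_div₀, map_mul,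
    hα σ, hα' σ, hσe]
  have h1 := GalMonoid.mu_val_ne_zero (Additive.toMul (c'.1 σ))
  have h2 := GalMonoid.mu_val_ne_zero (Additive.toMul (c.1 σ))
  field_simp

/-- `E^{×N} ≤ E^× ∩ L^{×N}` inside `E^×`. [cite: MochizukiFrdII2008, Rmk 2.2.1 p.18] -/
theorem range_powMonoidHom_le_comap :
    (powMonoidHom N : (invariantField L H hH S)ˣ →* (invariantField L H hH S)ˣ).range ≤
      ((powMonoidHom N : (L : Type)ˣ →* (L : Type)ˣ).range).comap
        (Units.map (algebraMap (invariantField L H hH S) L).toMonoidHom) := by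
  rintro _ ⟨e, rfl⟩
  refine ⟨Units.map (algebraMap (invariantField L H hH S) L).toMonoidHom e, ?_⟩
  rw [powMonoidHom_apply, powMonoidHom_apply, map_pow]

/-- **`#H¹(H_A, μ_N(O^□_L)) ≤ #((E^× ∩ L^{×N})/E^{×N})`** (FrdII Rmk. 2.2.1 p. 18, the first
cohomology portion of condition (c) "translated into extension field-theoretic language"): the
Hilbert-90 map `[c] ↦ [α_c^N]` from the continuous first cohomology of `H_A` with coefficients
`μ_N(O^□_L)` to `(E^× ∩ L^{×N})/E^{×N}` (`E = L^{H_A}`; the quotient rendered as the relative index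
of `E^{×N}` in `E^× ∩ L^{×N} ≤ E^×`) is injective; stated when `E^×/E^{×N}` is finite.
[cite: MochizukiFrdII2008, Rmk 2.2.1 p.18] -/
theorem natCard_h1_HA_le_card_kummerQuotient (hS : ∀ x : L, x ^ N = 1 → x ∈ S.toSubmonoid)
    (hN : N ≠ 0)
    (hfin : (powMonoidHom N :
      (invariantField L H hH S)ˣ →* (invariantField L H hH S)ˣ).range.index ≠ 0) :
    Nat.card (continuousCohomology 1 (Kummer.muTopRep N (GalMonoid S) (ofLocalField L H hH S).HA)) ≤
      (powMonoidHom N : (invariantField L H hH S)ˣ →* (invariantField L H hH S)ˣ).range.relIndex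
        (((powMonoidHom N : (L : Type)ˣ →* (L : Type)ˣ).range).comap
          (Units.map (algebraMap (invariantField L H hH S) L).toMonoidHom)) := by
  classical
  -- notation
  let E := invariantField L H hH S
  let R : Subgroup Eˣ := (powMonoidHom N : Eˣ →* Eˣ).range
  let T : Subgroup Eˣ := ((powMonoidHom N : (L : Type)ˣ →* (L : Type)ˣ).range).comap
    (Units.map (algebraMap E L).toMonoidHom)
  have hRT : R ≤ T := range_powMonoidHom_le_comap L H hH S N
  have hrel : R.relIndex T ≠ 0 := by
    intro h0
    apply hfin
    have h := Subgroup.relIndex_mul_index hRT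
    rw [h0, zero_mul] at h
    exact h.symm
  haveI : (R.subgroupOf T).FiniteIndex := ⟨hrel⟩
  -- representatives of classes and their Hilbert-90 elements
  let X₁ := Kummer.muTopRep N (GalMonoid S) (ofLocalField L H hH S).HA
  let rep : continuousCohomology 1 X₁ → contOneCocycles X₁ := fun γ =>
    (oneCocycleClass_surjective X₁ γ).choose
  have hrep : ∀ γ, oneCocycleClass X₁ (rep γ) = γ := fun γ =>
    (oneCocycleClass_surjective X₁ γ).choose_spec
  let α : continuousCohomology 1 X₁ → L := fun γ =>
    (exists_pow_eq_of_oneCocycle_HA L H hH S N (rep γ)).choose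
  have hα0 : ∀ γ, α γ ≠ 0 := fun γ =>
    (exists_pow_eq_of_oneCocycle_HA L H hH S N (rep γ)).choose_spec.1
  have hα : ∀ γ (σ : (ofLocalField L H hH S).HA), (σ : L ≃ₐ[K] L) (α γ) =
      ((Kummer.Mu.val (Additive.toMul ((rep γ).1 σ)) : (GalMonoid S)ˣ) : GalMonoid S).val * α γ :=
    fun γ => (exists_pow_eq_of_oneCocycle_HA L H hH S N (rep γ)).choose_spec.2.1
  have hαE : ∀ γ, α γ ^ N ∈ E := fun γ =>
    (exists_pow_eq_of_oneCocycle_HA L H hH S N (rep γ)).choose_spec.2.2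
  -- the unit `α^N ∈ E^× ∩ L^{×N}`
  have hαN0 : ∀ γ, (⟨α γ ^ N, hαE γ⟩ : E) ≠ 0 := fun γ h =>
    pow_ne_zero N (hα0 γ) (congrArg Subtype.val h)
  let u : continuousCohomology 1 X₁ → Eˣ := fun γ => Units.mk0 _ (hαN0 γ)
  have huT : ∀ γ, u γ ∈ T := fun γ => by
    refine ⟨Units.mk0 (α γ) (hα0 γ), Units.ext ?_⟩
    simp only [powMonoidHom_apply, Units.val_pow_eq_pow_val, Units.val_mk0, Units.coe_map,
      RingHom.toMonoidHom_eq_coe, MonoidHom.coe_coe, u]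
    rfl
  -- the injection
  let Ψ : continuousCohomology 1 X₁ → T ⧸ R.subgroupOf T := fun γ => QuotientGroup.mk ⟨u γ, huT γ⟩
  have hΨ : Function.Injective Ψ := by
    intro γ₁ γ₂ h
    obtain ⟨e, he⟩ := Subgroup.mem_subgroupOf.mp (QuotientGroup.eq.mp h)
    -- `u γ₁ · e^N = u γ₂` in `E^×`, read in `L`
    have he2 : u γ₁ * e ^ N = u γ₂ := by
      rw [← powMonoidHom_apply, he]
      exact mul_inv_cancel_left (u γ₁) (u γ₂)
    have he' : α γ₂ ^ N = α γ₁ ^ N * ((e : E) : L) ^ N := by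
      have h3 := congrArg (fun w : Eˣ => ((w : E) : L)) he2
      simp only [Units.val_mul, Units.val_pow_eq_pow_val, MulMemClass.coe_mul,
        SubmonoidClass.coe_pow, u, Units.val_mk0] at h3
      exact h3.symm
    have he0 : ((e : E) : L) ≠ 0 := by
      rw [Ne, ZeroMemClass.coe_eq_zero]; exact e.ne_zero
    have hcl := oneCocycleClass_eq_of_pow_eq (tE := tE) (tg := tg) L H hH S N hS hN (hα0 γ₂)
      (hα0 γ₁) he0 (e : E).2 (hα γ₂) (hα γ₁) he'
    rw [hrep, hrep] at hcl
    exact hcl.symm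
  exact Nat.card_le_card_of_injective Ψ hΨ

/-- **Remark 2.2.1, the counting conclusion** (FrdII p. 18: "any element `f ∈ O^□(A)^H` admits an
`N`-th root `g ∈ O^□(A)`", the `L`-part): if `E^×/E^{×N}` is finite (`E = L^{H_A}`) and
`#(E^×/E^{×N}) ≤ #H¹(H_A, μ_N(O^□_L))` — which the `p`-adic setting supplies through the unit-index
monotonicity `#(E^×/E^{×N}) ≤ #(M^×/M^{×N})` (`M = K̄^H`), the Kummer injection
`M^×/M^{×N} ↪ H¹(H, μ_N)` and condition (c) `H¹(H_A, μ_N(A)) ⥲ H¹(H, μ_N(A))` — then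
`E^× ∩ L^{×N}` has index `1` in `E^×`: every nonzero element of `E` is an `N`-th power in `L`.
[cite: MochizukiFrdII2008, Rmk 2.2.1 p.18] -/
theorem exists_pow_eq_of_index_le_natCard_h1 (hS : ∀ x : L, x ^ N = 1 → x ∈ S.toSubmonoid)
    (hN : N ≠ 0)
    (hfin : (powMonoidHom N :
      (invariantField L H hH S)ˣ →* (invariantField L H hH S)ˣ).range.index ≠ 0)
    (hle : (powMonoidHom N :
      (invariantField L H hH S)ˣ →* (invariantField L H hH S)ˣ).range.index ≤
        Nat.card (continuousCohomology 1
          (Kummer.muTopRep N (GalMonoid S) (ofLocalField L H hH S).HA)))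
    (x : invariantField L H hH S) (hx : x ≠ 0) : ∃ y : L, y ^ N = (x : L) := by
  let E := invariantField L H hH S
  let R : Subgroup Eˣ := (powMonoidHom N : Eˣ →* Eˣ).range
  let T : Subgroup Eˣ := ((powMonoidHom N : (L : Type)ˣ →* (L : Type)ˣ).range).comap
    (Units.map (algebraMap E L).toMonoidHom)
  have hRT : R ≤ T := range_powMonoidHom_le_comap L H hH S N
  have hmul : R.relIndex T * T.index = R.index := Subgroup.relIndex_mul_index hRT
  have hB := natCard_h1_HA_le_card_kummerQuotient (tE := tE) (tg := tg) L H hH S N hS hN hfin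
  have hrel : R.relIndex T ≠ 0 := fun h0 => hfin (by rw [← hmul, h0, zero_mul])
  have hT1 : T.index = 1 := by
    have h1 : R.relIndex T * T.index ≤ R.relIndex T * 1 := by
      rw [hmul, mul_one]; exact hle.trans hB
    have h2 : T.index ≤ 1 := Nat.le_of_mul_le_mul_left h1 (Nat.pos_of_ne_zero hrel)
    have h3 : T.index ≠ 0 := fun h0 => hfin (by rw [← hmul, h0, mul_zero])
    omega
  have hT : T = ⊤ := Subgroup.index_eq_one.mp hT1
  have hxT : Units.mk0 x hx ∈ T := by rw [hT]; exact Subgroup.mem_top _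
  obtain ⟨y, hy⟩ := hxT
  refine ⟨(y : L), ?_⟩
  have h := congrArg (fun w : (L : Type)ˣ => (w : L)) hy
  simp only [powMonoidHom_apply, Units.val_pow_eq_pow_val, Units.coe_map,
    RingHom.toMonoidHom_eq_coe, MonoidHom.coe_coe, Units.val_mk0] at h
  exact h

omit [Normal K L] [FiniteDimensional K L] [H.Normal] in
/-- **Definition 2.2 (ii)(c), first cohomology portion, counted** (FrdII p. 17): for an
`(N, H)`-saturated `A`, `#H¹(H_A, μ_N(A)) = #H¹(H, μ_N(A))` (`H` acting through `H ↠ H_A`). Stated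
for an ABSTRACT context `X`, so that the instances are those of the interface (see the note on
topologies in the module header). [cite: MochizukiFrdII2008, Def 2.2 (ii) p.17] -/
theorem natCard_h1_HA_eq_natCard_h1_H (X : Def22Context) (N : ℕ) (h : IsNHSaturated X N) :
    Nat.card (continuousCohomology 1 (Kummer.muTopRep N X.O X.HA)) =
      Nat.card (continuousCohomology 1
        (TopRep.res (X.qHA : X.H →* X.HA) (Kummer.muTopRep N X.O X.HA))) :=
  Nat.card_eq_of_bijective _ h.cohSaturated.bijective_one_mu

/-- **Remark 2.2.1, the counting conclusion over `(N, H)`-saturation** (FrdII p. 18): for an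
`(N, H)`-saturated `A` at the arithmetic context (`O^□_L ∋` the `N`-th roots of unity of `L`), if
`E^×/E^{×N}` is finite (`E = L^{H_A}`) and `#(E^×/E^{×N}) ≤ #H¹(H, μ_N(O^□_L))` — the `H`-side,
supplied in the `p`-adic setting by the unit-index monotonicity `#(E^×/E^{×N}) ≤ #(M^×/M^{×N})`
(`M = K̄^H`) and the Kummer injection `M^×/M^{×N} ↪ H¹(H, μ_N)` — then every nonzero element of `E`
is an `N`-th power in `L` (condition (c) `H¹(H_A, μ_N(A)) ⥲ H¹(H, μ_N(A))` and
`exists_pow_eq_of_index_le_natCard_h1`). This is the form the F-1198 closer consumes.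
[cite: MochizukiFrdII2008, Rmk 2.2.1 p.18] -/
theorem exists_pow_eq_of_isNHSaturated_of_index_le
    (hS : ∀ x : L, x ^ N = 1 → x ∈ S.toSubmonoid) (hN : N ≠ 0)
    (h : IsNHSaturated (ofLocalField L H hH S) N)
    (hfin : (powMonoidHom N :
      (invariantField L H hH S)ˣ →* (invariantField L H hH S)ˣ).range.index ≠ 0)
    (hle : (powMonoidHom N :
      (invariantField L H hH S)ˣ →* (invariantField L H hH S)ˣ).range.index ≤
        Nat.card (continuousCohomology 1
          (TopRep.res ((ofLocalField L H hH S).qHA :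
              (ofLocalField L H hH S).H →* (ofLocalField L H hH S).HA)
            (Kummer.muTopRep N (GalMonoid S) (ofLocalField L H hH S).HA))))
    (x : invariantField L H hH S) (hx : x ≠ 0) : ∃ y : L, y ^ N = (x : L) :=
  exists_pow_eq_of_index_le_natCard_h1 L H hH S N hS hN hfin
    (hle.trans_eq (natCard_h1_HA_eq_natCard_h1_H (ofLocalField L H hH S) N h).symm) x hx

end Def22Context
end PadicKummer
end Literature.AlgebraicGeometry.Frobenioids

end
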